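import Summits.MatrixMultiplication.MatrixMultiplication.Theorems.SoloBlindChainLemma

/-!
# Solo-blind seat (MatrixMultiplication), s71 — the 5-chain, realisability direction (paper/KraftK3.md §7.12, K3.12.14–15)

Continuation of `SoloBlindChainLemma` (`chain3_realise`, `chain4_realise`): the alternating 5-CHAIN of axis lines with junctions
`0, d₂, d₂ + d₃, d₂ + d₃ + d₄` has support the seven points `±d₁, −d₂, d₂ − d₃, d₂ + d₃ − d₄, d₂ + d₃ + d₄ ± d₅`; if the values satisfy the
alternating relation `Q d₁ + Q d₃ + Q d₅ = Q d₂ + Q d₄` then for the explicit linear part below all seven lie in `{Q + ℓ = Q d₁}`.  With the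
3-chain, 4-chain and comb lemmas this covers every unit-free relation plane of `𝔽₃⁵` (enumeration: the 10 planes escaping the shorter types have
a vector of type (5,2)), which is the algebra of 'no universal frame for anisotropic systems of rank ≤ 3 on `𝔽₃⁵`'.  Pure algebra over
`ZMod 3`; no `ω` content.
-/

set_option linter.dupNamespace false
set_option autoImplicit false

namespace Summit.MatrixMultiplication.MatrixMultiplication.Theorems

variable {M N : Type*} [AddCommGroup M] [Module (ZMod 3) M] [AddCommGroup N] [Module (ZMod 3) N]

/-- 5-CHAIN, realisability: with `ℓ d₁ = 0`, `ℓ d₂ = Q d₂ - Q d₁`, `ℓ d₃ = Q d₁ - Q d₂ + Q d₃ - polar Q d₂ d₃`,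
`ℓ d₄ = -Q d₁ + Q d₂ - Q d₃ + Q d₄ - polar Q (d₂ + d₃) d₄`, `ℓ d₅ = -polar Q (d₂ + d₃ + d₄) d₅` and the alternating relation
`Q d₁ + Q d₃ + Q d₅ = Q d₂ + Q d₄`, the seven support points of the 5-chain lie in `{Q + ℓ = Q d₁}`. -/
theorem chain5_realise (Q : QuadraticMap (ZMod 3) M N) (ℓ : M →ₗ[ZMod 3] N) (d₁ d₂ d₃ d₄ d₅ : M)
    (h1 : ℓ d₁ = 0) (h2 : ℓ d₂ = Q d₂ - Q d₁) (h3 : ℓ d₃ = Q d₁ - Q d₂ + Q d₃ - QuadraticMap.polar Q d₂ d₃)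
    (h4 : ℓ d₄ = -Q d₁ + Q d₂ - Q d₃ + Q d₄ - QuadraticMap.polar Q (d₂ + d₃) d₄)
    (h5 : ℓ d₅ = -QuadraticMap.polar Q (d₂ + d₃ + d₄) d₅) (hrel : Q d₁ + Q d₃ + Q d₅ = Q d₂ + Q d₄) :
    Q d₁ + ℓ d₁ = Q d₁ ∧ Q (-d₁) + ℓ (-d₁) = Q d₁ ∧ Q (-d₂) + ℓ (-d₂) = Q d₁ ∧ Q (d₂ - d₃) + ℓ (d₂ - d₃) = Q d₁ ∧
      Q (d₂ + d₃ - d₄) + ℓ (d₂ + d₃ - d₄) = Q d₁ ∧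
      Q (d₂ + d₃ + d₄ + d₅) + ℓ (d₂ + d₃ + d₄ + d₅) = Q d₁ ∧ Q (d₂ + d₃ + d₄ - d₅) + ℓ (d₂ + d₃ + d₄ - d₅) = Q d₁ := by
  have h5' : Q d₅ = Q d₂ + Q d₄ - Q d₁ - Q d₃ := by rw [← hrel]; abel
  have e2 := three_smul_eq_zero_zmod3 (Q d₂)
  refine ⟨?_, ?_, ?_, ?_, ?_, ?_, ?_⟩
  · rw [h1, add_zero]
  · rw [QuadraticMap.map_neg, map_neg, h1, neg_zero, add_zero]
  · rw [QuadraticMap.map_neg, map_neg, h2]; abel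
  · rw [sub_eq_add_neg d₂ d₃, QuadraticMap.map_add Q d₂ (-d₃), QuadraticMap.map_neg, QuadraticMap.polar_neg_right, map_add, map_neg, h2, h3]
    linear_combination (norm := skip) e2
    match_scalars <;> decide
  · rw [sub_eq_add_neg (d₂ + d₃) d₄, QuadraticMap.map_add Q (d₂ + d₃) (-d₄), QuadraticMap.map_neg, QuadraticMap.polar_neg_right,
      QuadraticMap.map_add Q d₂ d₃, map_add, map_add, map_neg, h2, h3, h4]
    linear_combination (norm := skip) e2
    match_scalars <;> decide
  · rw [QuadraticMap.map_add Q (d₂ + d₃ + d₄) d₅, QuadraticMap.map_add Q (d₂ + d₃) d₄, QuadraticMap.map_add Q d₂ d₃,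
      map_add, map_add, map_add, h2, h3, h4, h5, h5']
    linear_combination (norm := skip) e2
    match_scalars <;> decide
  · rw [sub_eq_add_neg (d₂ + d₃ + d₄) d₅, QuadraticMap.map_add Q (d₂ + d₃ + d₄) (-d₅), QuadraticMap.map_neg, QuadraticMap.polar_neg_right,
      QuadraticMap.map_add Q (d₂ + d₃) d₄, QuadraticMap.map_add Q d₂ d₃, map_add, map_add, map_add, map_neg, h2, h3, h4, h5, h5']
    linear_combination (norm := skip) e2
    match_scalars <;> decide

end Summit.MatrixMultiplication.MatrixMultiplication.Theorems
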